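import Literature.NumberTheory.DiophantineGeometry.OptimizedSimplifiedHeightBoundsProofs
import HarnessLib

/-!
# von Känel–Matschke, (eq:simplemordell): `max(h(x), h(y)) ≤ ½ h(a) + a_S log a_S` (proofs)

Topic `Literature/NumberTheory/DiophantineGeometry` (family `abc`). A proofs-only companion (theorems only; NO
definition, NO new named fact; D-0014, D-0026) of `SUnitMordellHeightBoundsModularity.lean` (Prop. 10.1 =
`mordell_height_le`). R. von Känel, B. Matschke, arXiv:1605.06079 = Mem. AMS 286 (2023) [`VonkanelMatschke2023`],
§10.1.1, display (eq:simplemordell): *"we suppose that `x, y ∈ 𝒪` satisfy `y² = x³ + a` and we observe that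
Proposition 10.1 implies `max(h(x), h(y)) ≤ ½ h(a) + a_S log a_S`"* ("Proposition (eq:simplemordell) provides the
actual best height bound for Mordell equations … it updates `h(a) + 4·36a_S log(36a_S)²` in [vK 2014]").

Proof: `h(x) ≤ Ω_sim`, `h(y) ≤ (3/2)Ω_sim` with `Ω_sim = ⅓h(a) + (4/9)A log A + (1/6)A log₃A + (2/5)A`,
`A = a_S ≥ 1728`, and `log₃A ≤ log A − 2`, so `(3/2)((4/9)A log A + (1/6)A log₃A + (2/5)A) ≤ A log A`.

* `eq_simplemordell_of_mordell_height_le (h : mordell_height_le)`;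
* `eq_simplemordell_of_roots (hmod) (h103) (hi)` — from {modularity, Lemma 10.3, Prop. 10.8 (i)}.
-/

noncomputable section

open Height
open Literature.NumberTheory.EllipticCurves.ModularForms

namespace Literature.NumberTheory.DiophantineGeometry

namespace VonKanelMatschke

/-- **(eq:simplemordell) ⟸ Prop. 10.1** (PROVED): *"if `x, y ∈ 𝒪` satisfy `y² = x³ + a` then
`max(h(x), h(y)) ≤ ½ h(a) + a_S log a_S`"*. [cite: VonkanelMatschke2023, §10.1.1 display (eq:simplemordell)] -/
theorem eq_simplemordell_of_mordell_height_le (h : mordell_height_le) :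
    ∀ (S : Finset ℕ), (∀ p ∈ S, p.Prime) → ∀ a : ℚ, a ≠ 0 → IsSInteger S a →
      ∀ x y : ℚ, IsSInteger S x → IsSInteger S y → y ^ 2 = x ^ 3 + a →
        max (logHeight₁ x) (logHeight₁ y) ≤
          1 / 2 * logHeight₁ a + (mordellLevel S a : ℝ) * Real.log (mordellLevel S a) := by
  intro S hS a ha haS x y hx hy hxy
  have hΩ := h S hS a ha haS x y hx hy hxy
  rw [omegaSim] at hΩ
  have hA : (1728 : ℝ) ≤ (mordellLevel S a : ℝ) := by exact_mod_cast le_mordellLevel hS a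
  set A : ℝ := (mordellLevel S a : ℝ) with hAdef
  have hA0 : 0 < A := by linarith
  have hlogA : 6.9 ≤ Real.log A := by
    have h1 : Real.log (1024 : ℝ) ≤ Real.log A := Real.log_le_log (by norm_num) (by linarith)
    rw [show (1024 : ℝ) = 2 ^ 10 by norm_num, Real.log_pow] at h1
    have := Real.log_two_gt_d9
    push_cast at h1; linarith
  have hll : Real.log (Real.log A) ≤ Real.log A - 1 := Real.log_le_sub_one_of_pos (by linarith)
  have hll0 : 0 < Real.log (Real.log A) := Real.log_pos (by linarith)
  have hl3 : Real.log (Real.log (Real.log A)) ≤ Real.log (Real.log A) - 1 := Real.log_le_sub_one_of_pos hll0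
  have p1 : A * Real.log (Real.log (Real.log A)) ≤ A * (Real.log A - 2) :=
    mul_le_mul_of_nonneg_left (by linarith) hA0.le
  have p2 : A * 6.9 ≤ A * Real.log A := mul_le_mul_of_nonneg_left hlogA hA0.le
  have hha : 0 ≤ logHeight₁ a := zero_le_logHeight₁ a
  have hx' : logHeight₁ x ≤ 1 / 3 * logHeight₁ a + 4 / 9 * A * Real.log A +
      1 / 6 * A * Real.log (Real.log (Real.log A)) + 2 / 5 * A := (le_max_left _ _).trans hΩ
  have hy' : 2 / 3 * logHeight₁ y ≤ 1 / 3 * logHeight₁ a + 4 / 9 * A * Real.log A +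
      1 / 6 * A * Real.log (Real.log (Real.log A)) + 2 / 5 * A := (le_max_right _ _).trans hΩ
  exact max_le (by nlinarith) (by nlinarith)

/-- **(eq:simplemordell) ⟸ {modularity, Lemma 10.3, Prop. 10.8 (i)}** (through
`mordell_height_le_of_lemma_10_3_of_prop_10_8_i`). [cite: VonkanelMatschke2023, §10.1.1 display (eq:simplemordell)] -/
theorem eq_simplemordell_of_roots (hmod : nonempty_modularParametrizationData)
    (h103 : vonKanelMatschke_lemma_10_3) (hi : vonKanelMatschke_prop_10_8_i) :
    ∀ (S : Finset ℕ), (∀ p ∈ S, p.Prime) → ∀ a : ℚ, a ≠ 0 → IsSInteger S a →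
      ∀ x y : ℚ, IsSInteger S x → IsSInteger S y → y ^ 2 = x ^ 3 + a →
        max (logHeight₁ x) (logHeight₁ y) ≤
          1 / 2 * logHeight₁ a + (mordellLevel S a : ℝ) * Real.log (mordellLevel S a) :=
  eq_simplemordell_of_mordell_height_le (mordell_height_le_of_lemma_10_3_of_prop_10_8_i hmod h103 hi)

end VonKanelMatschke

end Literature.NumberTheory.DiophantineGeometry

end
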